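import Summits.Schanuel.Schanuel.Theorems.RootDecomp1KXAll03

/-!
# RootDecomp1KXAll — lens 1, generation 46, node 5 «ALL CURVES: ThinFibreAt m₀ P for EVERY P ∈ ℤ[x][Y], P ≠ 0, at every m₀ ≥ thinThreshold P = max(3, 2·μ(P)+1, e(P)+1)» (CLAIM L2336, PRICE + CHECKLIST K-g46 L2337, NODE L2353, critic VERDICT L2357: CLEARED THEOREM ×1 under K-R35 — the last threshold-THEOREM of the K-line, UNCONDITIONAL; PORT GO L2357) — continuation (RootDecomp1KXAll04): §XIV.7 consumer for all x-degrees

(lens-1 g46 HOME kernel K₅ = HOME/decomp-schanuel-lens-1/g46/XAll.lean 4f432885…, 1310 l, ONE import …RootDecomp1KXTop03; P₅/C₅ + NODE-g46.md. Port by census-1 gen 20 as `RootDecomp1KXAll01–06` (the memo's 01–05 split with §XIV.8 cut in two by the 400-line cap): 01 = private helper copies + §XIV.1 roots with multiplicity in `ℂ₂` and the nearest-root lemma without separability (`roots_data_mult`, `nearest_root_mult`, `rootMultiplicity_le_one_of_separable`, `rootMultiplicity_le_natDegree'`) + §XIV.2 Ridout for rationals with exponent `κ = a/b > 2` (`ridout_one_pow`,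 `ridout_window_pow`; tree `Ridout.finite_of_abs_le_one` BY NAME, called once); 02 = §XIV.3 the dichotomy with multiplicity (`near_root_or_at_infinity_mult`) + §XIV.4 its arithmetic end (`dichotomy_arith_mult`); 03 = §XIV.5 THE PARAMETRIC THEOREM `thinFibreAt_xPoly_mult` (+ `_claim`, `_again` private, `_crude`) + §XIV.6 every `P ∈ ℤ[x][Y]` (`xCoeff`, `topX`, `eTop`, `muTop`, `thinThreshold`, `xPolyP_xCoeff`, **`thinFibreAt_all`**, `thinFibreAt_effective`); 04 = §XIV.7 CONSUMER for all x-degrees (`xCoeff_dX`, …, `thinThreshold_dX_le`, `no_relation_of_closed_class`, `allCurves_nonvanishing`); 05 = §XIV.8 thresholds of `xPolyP k c` in the data `(μ, e)`, specialisations BY NAME (examples against tree `…XTop.thinFibreAt_xPoly`, `…XLinearII.thinFibreAt_xLinear_sep`, `ridout_window`, `dichotomy_arith`), root-multiplicity bounds, the P₃-family `thinFibreAt_purePowerTop`; 06 = members P₁ P₂ P₃ with thresholds 5 / 7 / 5 proved as theorems + CONSUMER at the members.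
PORT EDITS (sanctioned in VERDICT L2357 (a)–(e)): `set_option linter.dupNamespace false` dropped; `thinFibreAt_xPoly_again` and `thinFibreAt_xLinear_sep_again` (type-twins of tree `…XTop.thinFibreAt_xPoly` / `…XLinearII.thinFibreAt_xLinear_sep`) made `private` (dedup); per-part private helper copies; the two scoped `set_option maxHeartbeats 400000 in` kept as in K₅; `example` blocks kept; 19 one-line docstrings added (gate lint.docstring); statements and proofs otherwise verbatim. `--supports stmt-Schanuel-33364`; no census credit carried; rung 0 — nothing here proves Schanuel; no ∀-item of 1K moves.)
-/

noncomputable section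

namespace Summit.Schanuel.Schanuel.Theorems.RootDecomp1KXAll

open Polynomial LiouvilleNumber
open scoped Nat
open Summit.Schanuel.Schanuel.Theorems.RootDecomp1KSkelCell
  (exists_le_two_pow_factorial iota iota_spec iota_le_of_le pow_lt_of_lt_iota lt_iota_of_pow_lt iota_mono
   one_le_iota SkelLiouville SkelLiouvilleFix skelLiouville_iff_fix SkelLiouvilleFix.mono uStar dU rU dU_cast
   two_pow_le_four_mul_dU two_mul_dU_lt one_le_dU rU_den rU_cast uStar_sub_rU skelLiouvilleFix_one_uStar
   not_skelFixOne_algebraicIndependent)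
open Summit.Schanuel.Schanuel.Theorems.RootDecomp1KTwoBaseCell (psNumer partialSum_eq_psNumer_div coprime_psNumer
  algebraicIndependent_of_forall_int')
open Summit.Schanuel.Schanuel.Theorems.RootDecomp1KRelLiouvilleCell (partialSum_two_strictMono
  partialSum_two_lt_liouvilleNumber abs_liouvilleNumber_two_sub_partialSum)
open Summit.Schanuel.Schanuel.Theorems.RootDecomp1KDegreeLadder
open Summit.Schanuel.Schanuel.Theorems.RootDecomp1KXLinearCore
open Summit.Schanuel.Schanuel.Theorems.RootDecomp1KXLinear
open Summit.Schanuel.Schanuel.Theorems.RootDecomp1KXLinearII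
open Summit.Schanuel.Schanuel.Theorems.RootDecomp1KXTop

/-- `ℓ₂ = liouvilleNumber 2` is Liouville (Mathlib). -/
private theorem liouville_ell2' : Liouville (liouvilleNumber 2) := by
  have h := liouville_liouvilleNumber (le_refl 2)
  simpa using h

/-! ## §XIV.7  CONSUMER for ALL `x`-degrees: `∂ₓ`-descent inside the descent-closed class `{thinThreshold ≤ m}` -/

/-- `x`-coefficients of `dX P`: `xCoeff (dX P) j = (j+1) · xCoeff P (j+1)`. -/
theorem xCoeff_dX (P : ℤ[X][X]) (j : ℕ) : xCoeff (dX P) j = C (((j + 1 : ℕ) : ℤ)) * xCoeff P (j + 1) := by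
  ext i
  rw [coeff_xCoeff, coeff_dX, coeff_derivative, coeff_C_mul, coeff_xCoeff]
  push_cast
  ring

/-- `xdeg (dX P) = xdeg P − 1` (for `xdeg P ≥ 1`). -/
theorem xdeg_dX (P : ℤ[X][X]) (hP : P ≠ 0) (hx : 1 ≤ xdeg P) : xdeg (dX P) = xdeg P - 1 := by
  have hlt := xdeg_dX_lt hx
  have hge : xdeg P - 1 ≤ xdeg (dX P) := by
    apply le_xdeg_of_xCoeff_ne_zero
    rw [xCoeff_dX, show xdeg P - 1 + 1 = xdeg P by omega]
    refine mul_ne_zero (C_ne_zero.mpr ?_) (topX_ne_zero hP)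
    exact_mod_cast (show xdeg P ≠ 0 by omega)
  omega

/-- the top `x`-coefficient of `dX P` is `k · c_k`. -/
theorem topX_dX (P : ℤ[X][X]) (hP : P ≠ 0) (hx : 1 ≤ xdeg P) : topX (dX P) = C ((xdeg P : ℕ) : ℤ) * topX P := by
  unfold topX
  rw [xdeg_dX P hP hx, xCoeff_dX, show xdeg P - 1 + 1 = xdeg P by omega]

/-- `μ` is invariant under `∂ₓ`: same roots, same multiplicities (`char 0`). -/
theorem muTop_dX (P : ℤ[X][X]) (hP : P ≠ 0) (hx : 1 ≤ xdeg P) : muTop (dX P) = muTop P := by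
  classical
  have hk : (((xdeg P : ℕ) : ℤ) : PadicAlgCl 2) ≠ 0 := by
    have : ((xdeg P : ℕ) : PadicAlgCl 2) ≠ 0 := by exact_mod_cast (show xdeg P ≠ 0 by omega)
    simpa using this
  set p := (topX P).map (algebraMap ℤ (PadicAlgCl 2)) with hp
  have hp0 : p ≠ 0 :=
    (Polynomial.map_ne_zero_iff (algebraMap ℤ (PadicAlgCl 2)).injective_int).mpr (topX_ne_zero hP)
  have hmap : (topX (dX P)).map (algebraMap ℤ (PadicAlgCl 2)) = C (((xdeg P : ℕ) : ℤ) : PadicAlgCl 2) * p := by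
    rw [topX_dX P hP hx, Polynomial.map_mul, map_C, hp]
    simp
  have hroots : (C (((xdeg P : ℕ) : ℤ) : PadicAlgCl 2) * p).roots = p.roots := roots_C_mul p hk
  have hmult : ∀ β, rootMultiplicity β (C (((xdeg P : ℕ) : ℤ) : PadicAlgCl 2) * p) = rootMultiplicity β p := by
    intro β
    rw [rootMultiplicity_mul (mul_ne_zero (C_ne_zero.mpr hk) hp0), rootMultiplicity_C, zero_add]
  unfold muTop
  rw [hmap, hroots]
  exact Finset.sup_congr rfl fun β _ => hmult β

/-- `e` can only drop under `∂ₓ`. -/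
theorem eTop_dX_le (P : ℤ[X][X]) (hP : P ≠ 0) (hx : 1 ≤ xdeg P) : eTop (dX P) ≤ eTop P := by
  unfold eTop
  rw [topX_dX P hP hx, natDegree_C_mul (by exact_mod_cast (show xdeg P ≠ 0 by omega))]
  have := natDegree_dX_le P
  omega

/-- **the class `{thinThreshold ≤ m}` is descent-closed.** -/
theorem thinThreshold_dX_le (P : ℤ[X][X]) (hP : P ≠ 0) (hx : 1 ≤ xdeg P) :
    thinThreshold (dX P) ≤ thinThreshold P := by
  unfold thinThreshold
  rw [muTop_dX P hP hx]
  have := eTop_dX_le P hP hx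
  omega

/-- DESCENT inside a DESCENT-CLOSED class (node-1's `no_relation_of_engine`, the bound `deg_Y ≤ d` replaced by an
arbitrary predicate `Cl` closed under `∂ₓ`): if `ρ` is transcendental and an engine refutes every relation
`Q(ℓ₂, ρ) = 0` in the class with `deg_Y Q ≥ 1` and `∂Q/∂x (ℓ₂, ρ) ≠ 0`, then NO `P` in the class is a relation —
a relation of minimal `x`-degree in the class is non-degenerate (else `dX Q` is a smaller relation IN THE CLASS). -/
theorem no_relation_of_closed_class {ρ : ℝ} (Cl : ℤ[X][X] → Prop) (hρT : Transcendental ℤ ρ)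
    (hCl : ∀ Q : ℤ[X][X], Q ≠ 0 → 1 ≤ xdeg Q → Cl Q → Cl (dX Q))
    (hE : ∀ Q : ℤ[X][X], Q ≠ 0 → 1 ≤ Q.natDegree → Cl Q →
      bev Q (liouvilleNumber 2) ρ = 0 → bev (dX Q) (liouvilleNumber 2) ρ ≠ 0 → False)
    (P : ℤ[X][X]) (hP : P ≠ 0) (hClP : Cl P) : bev P (liouvilleNumber 2) ρ ≠ 0 := by
  classical
  intro hroot
  have hex : ∃ n, ∃ Q : ℤ[X][X], Q ≠ 0 ∧ Cl Q ∧ bev Q (liouvilleNumber 2) ρ = 0 ∧ xdeg Q = n :=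
    ⟨_, P, hP, hClP, hroot, rfl⟩
  obtain ⟨Q, hQ0, hQCl, hQroot, hQx⟩ := Nat.find_spec hex
  have hmin : ∀ Q' : ℤ[X][X], Q' ≠ 0 → Cl Q' → bev Q' (liouvilleNumber 2) ρ = 0 → xdeg Q ≤ xdeg Q' := by
    intro Q' h1 h2 h3
    rw [hQx]
    exact Nat.find_min' hex ⟨Q', h1, h2, h3, rfl⟩
  by_cases hx : xdeg Q = 0
  · have hrel := bev_eq_aeval_of_xdeg_eq_zero hx (liouvilleNumber 2) ρ
    rw [hQroot] at hrel
    set R : ℤ[X] := ∑ j ∈ Finset.range (Q.natDegree + 1), C ((Q.coeff j).coeff 0) * X ^ j with hR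
    have hR0 : R ≠ 0 := by
      intro h0
      have hlc : Q.leadingCoeff ≠ 0 := leadingCoeff_ne_zero.mpr hQ0
      have hc : R.coeff Q.natDegree = (Q.coeff Q.natDegree).coeff 0 := by
        rw [hR, finsetSum_coeff]
        simp only [coeff_C_mul, coeff_X_pow, mul_ite, mul_one, mul_zero]
        rw [Finset.sum_ite_eq, if_pos (Finset.mem_range.mpr (Nat.lt_succ_self _))]
      have hdeg0 : (Q.coeff Q.natDegree).natDegree = 0 := by
        have := natDegree_coeff_le_xdeg Q Q.natDegree; omega
      have hQC : Q.coeff Q.natDegree = C ((Q.coeff Q.natDegree).coeff 0) :=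
        eq_C_of_natDegree_eq_zero hdeg0
      apply hlc
      rw [leadingCoeff, hQC, ← hc, h0, coeff_zero, C_0]
    exact hρT ⟨R, hR0, hrel.symm⟩
  · have hx1 : 1 ≤ xdeg Q := by omega
    have hτ : bev (dX Q) (liouvilleNumber 2) ρ ≠ 0 := by
      intro h0
      have h1 := hmin (dX Q) (dX_ne_zero hx1) (hCl Q hQ0 hx1 hQCl) h0
      have h2 := xdeg_dX_lt hx1
      omega
    by_cases hQd : Q.natDegree = 0
    · have hQC : Q = C (Q.coeff 0) := eq_C_of_natDegree_eq_zero hQd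
      have h1 : bev Q (liouvilleNumber 2) ρ = aeval (liouvilleNumber 2) (Q.coeff 0) := by
        rw [hQC, bev_C, coeff_C_zero]
      have hQ00 : Q.coeff 0 ≠ 0 := by intro h; apply hQ0; rw [hQC, h, C_0]
      exact liouville_ell2'.transcendental ⟨Q.coeff 0, hQ00, by rw [← h1, hQroot]⟩
    · exact hE Q hQ0 (by omega) hQCl hQroot hτ

/-- **CONSUMER (all `x`-degrees).**  For `ρ ∈ Skel₍m₎` and every `P ≠ 0` with `thinThreshold P ≤ m`:
`P(ℓ₂, ρ) ≠ 0`.  The `∂P/∂x`-non-degeneracy the engine needs is supplied by the descent: the class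
`{Q ≠ 0 : thinThreshold Q ≤ m}` is closed under `∂ₓ` (`thinThreshold_dX_le`), so a relation of minimal `x`-degree in it
has `∂Q/∂x (ℓ₂, ρ) ≠ 0`, and `thinFibreAt_all Q` feeds `engine_of_clause`. -/
theorem allCurves_nonvanishing {m : ℕ} {ρ : ℝ} (hρ : SkelLiouvilleFix m ρ) (P : ℤ[X][X]) (hP : P ≠ 0)
    (hm : thinThreshold P ≤ m) : bev P (liouvilleNumber 2) ρ ≠ 0 := by
  have hm1 : 1 ≤ m := le_trans (by norm_num) ((three_le_thinThreshold P).trans hm)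
  refine no_relation_of_closed_class (fun Q => thinThreshold Q ≤ m) (hρ.transcendental hm1)
    (fun Q hQ0 hx hQ => (thinThreshold_dX_le Q hQ0 hx).trans hQ) (fun Q hQ0 hd hQ hroot hτ => ?_) P hP hm
  exact engine_of_clause hm1 hd hroot hτ hρ (thinFibreAt_all Q hQ0 hQ)

/-- the consumer in the data `(μ, e)`: `m ≥ 3`, `m ≥ 2μ(P)+1`, `m ≥ e(P)+1`. -/
theorem allCurves_nonvanishing' {m : ℕ} {ρ : ℝ} (hρ : SkelLiouvilleFix m ρ) (P : ℤ[X][X]) (hP : P ≠ 0)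
    (h3 : 3 ≤ m) (hμ : 2 * muTop P + 1 ≤ m) (he : eTop P + 1 ≤ m) : bev P (liouvilleNumber 2) ρ ≠ 0 :=
  allCurves_nonvanishing hρ P hP (max_le h3 (max_le hμ he))

end Summit.Schanuel.Schanuel.Theorems.RootDecomp1KXAll

end
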